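import Mathlib.SetTheory.Cardinal.Continuum
import Mathlib.Analysis.Complex.Cardinality
import Literature.NumberTheory.Transcendental.ExpVarieties
import Literature.NumberTheory.Transcendental.ZilberField
import Literature.ModelTheory.ExponentialFields.ExponentialField
import Literature.ModelTheory.ExponentialFields.Languages
import Literature.ModelTheory.ExponentialFields.ModelTheoryPreds
import Literature.NumberTheory.Transcendental.PeriodsWave0
import Literature.ModelTheory.ExponentialFields.RealExpField
import HarnessLib
import HarnessLib.Audit

-- provenance: harness21/H21/H21/Statements/Periods/Zilber.lean @ e53059b (interim HEAD d8f2665); M5 mechanical rewrite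
/-!
# Periods family — Zilber's conjecture on the complex exponential field (periods.S30)

Family `periods`, trunk TranscendKaehlerL (item `ZilberStmt`). This file states inventory item
**periods.S30**:

> Zilber: `ℂ_exp` is isomorphic to the pseudo-exponential field of cardinality continuum
> (weak form: `ℂ_exp` is quasiminimal).

## Contents

* `Literature.NumberTheory.Transcendental.ZilberConjecture : Prop := IsZilberField ℂ` — the
  strong form; an OPEN CONJECTURE registered as a statement (CONVENTIONS §4: `def … : Prop`,
  docstring `OPEN CONJECTURE — … [status: open]`), not named-fact debt — see
  `## Open conjecture` below.
* The equivalence with the literal "`ℂ_exp ≅ 𝔹`" form — every Zilber field of cardinality `𝔠`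
  is E-ring isomorphic to `ℂ_exp` — is NOT declared in this file: it is the proved theorem
  `Literature.NumberTheory.Transcendental.zilberConjecture_iff_forall_nonempty_equiv_of` of the
  sibling proof file `ZilberProofs.lean`, granted Zilber's categoricity and existence theorems
  (the named facts `Literature.NumberTheory.Transcendental.zilber_categoricity` and
  `Literature.NumberTheory.Transcendental.exists_isZilberField_of_aleph0_lt` of `ZilberField.lean`),
  next to the unconditional existential variant
  `Literature.NumberTheory.Transcendental.zilberConjecture_iff_exists_nonempty_equiv`; see
  `## Merged named fact` below.
* (Interim declarations `zilberConjecture_iff_schanuel_and_seac` — Bays–Kirby 2018 Thm 1.4,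
  Zilber's conjecture ↔ Schanuel + strong exponential-algebraic closedness — and
  `zilberConjecture_of_isExpAlgClosed` — SEAC from EAC + Schanuel, mis-cited there as "Kirby 2013":
  that step is open unconditionally (Kirby 2013 §2.3, remark) and known only under CIT
  (Kirby–Zilber 2014, Thm 1.5 = Thm 5.7 of §5.4; "Theorem 5.5" in the 2011 preprint numbering
  cited by Kirby 2013), see `Literature.NumberTheory.Transcendental.IsZilberField.of_isExpAlgClosed` in `ZilberField.lean` and its
  CIT-conditional form `Literature.NumberTheory.Transcendental.IsZilberField.of_isExpAlgClosed_of_cit` in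
  `IntersectionsWithTori.lean` — of the harness21 file are not part of this M5 import.)
* `Literature.NumberTheory.Transcendental.hasStandardKernel_complex` — `ker exp = 2πiℤ` with `2πi` transcendental
  (named fact; discharged as `Literature.NumberTheory.Transcendental.hasStandardKernel_complex_holds`
  in `ZilberProofs.lean` from Lindemann's theorem `transcendental_pi_holds` and
  `Literature.NumberTheory.Transcendental.hasStandardKernel_complex_of_transcendental_pi`).
* Weak form: `Literature.NumberTheory.Transcendental.zilberQuasiminimality_of_zilberConjecture`,
  `Literature.NumberTheory.Transcendental.zilberQuasiminimalityConjecture_iff` (`Iff.rfl` with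
  `Language.expRing.IsQuasiminimal ℂ`), `Literature.NumberTheory.Transcendental.isQuasiminimal_of_isExpAlgClosed`
  (Bays–Kirby 2018 Thm 1.5: EAC alone already implies quasiminimality of `ℂ_exp`); both named
  facts are discharged in sibling proof files
  (`Literature.NumberTheory.Transcendental.zilberQuasiminimality_of_zilberConjecture_holds`,
  `ZilberFieldQuasiminimalityProofs.lean`;
  `Literature.NumberTheory.Transcendental.isQuasiminimal_of_isExpAlgClosed_holds`, `ZilberThm15.lean`).

## Open conjecture (verdict clean-up 2026-08-15)

`ZilberConjecture` (= `IsZilberField ℂ`, Bays–Kirby 2018 Conjecture 1.3 "`ℂ_exp` is isomorphic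
to the unique model `𝔹` of `ECF_{SK,CCP}` of cardinality continuum", read through the
categoricity Theorem 1.2 = Theorem 9.1) was seated as a named fact to be discharged; its tenured
prove-seat returned `open-problem`, and the verdict was re-read against the source and the tree
and stands. (i) It is POSED as a conjecture, not a theorem: Zilber 2005 (Conjecture, p. 68) and
Bays–Kirby 2018 (arXiv p. 3), Conjecture 1.3; Gallinaro–Kirby 2024 (arXiv:2304.06450, §1.1, p. 4): "Zilber then conjectured that
`ℂ_exp ≅ 𝔹_exp`, which implies Conjecture 1.1, but is much stronger, since it incorporates
Schanuel's Conjecture of transcendental number theory. In fact, it is equivalent to that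
conjecture together with another conjectural property for `ℂ_exp`, called Strong
Exponential-Algebraic Closedness (SEAC)". (ii) That equivalence is Bays–Kirby 2018 Theorem 1.4,
PROVED in the tree, unconditionally, as
`Literature.NumberTheory.Transcendental.zilberConjecture_iff_schanuelConjecture_and_isStronglyExpAlgClosed`
(`ZilberProofs.lean`): `ZilberConjecture ↔ SchanuelProperty ℂ ∧ IsStronglyExpAlgClosed ℂ`, the
other four fields of `IsZilberField ℂ` (axioms 1, 2 and 5 of Theorem 9.1) being theorems for
`ℂ_exp` (`Complex.isAlgClosed`, `isSurjectiveOntoUnits_complex`, `hasStandardKernel_complex_holds`,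
`hasCountableClosureProperty_complex_holds`). (iii) Both conjuncts are open: "Schanuel's
conjecture is considered out of reach, since even the very simple consequence that the numbers
`e` and `π` are algebraically independent is unknown" (Bays–Kirby 2018, arXiv p. 3); Schanuel's
conjecture is "a famous open problem in transcendental number theory" (Aslanyan–Gallinaro 2024,
arXiv:2409.12860, §3.5, p. 15); and already the weak form it implies (`zilberQuasiminimality_of_zilberConjecture_holds`),
Zilber's quasiminimality conjecture, "is still unresolved" (Wilkie 2024, arXiv:2306.14562, p. 2). Hence no
`ZilberConjecture_holds` is to be expected: the docstring now starts `OPEN CONJECTURE —`, cites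
where the conjecture is posed and carries `[status: open]`; the statement `IsZilberField ℂ` is
unchanged. The name is kept (it already has the `…Conjecture` form and is used by
`ZilberProofs.lean`, `ZilberFieldQuasiminimalityProofs.lean`, the barrier
`Literature.Barriers.Schanuel.AxiomsDoNotForceSchanuel` and the route file
`Summits/Schanuel/Schanuel/Theses/Zilber.lean`, whose assembly is the projection
`ZilberConjecture → Schanuel`). Users keep it as an explicit hypothesis `(h : ZilberConjecture)`.
The 2005 text of Zilber is not held here (paywalled, acquisition request acq-00158); the
Conjecture 1.3 / Theorem 1.4 / Theorem 9.1 wording was checked on the arXiv version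
(arXiv:1512.04262, pp. 3 and 28).

## Merged named fact (D-0026 split review 2026-08-15)

The harness21 file carried a sorried theorem `zilberConjecture_iff_forall_nonempty_equiv :
ZilberConjecture ↔ ∀ B, IsZilberField B → #B = 𝔠 → Nonempty (ExponentialRingEquiv B ℂ)`, which
the M5 import demoted to a named fact `def … : Prop` of this file. Read against the source it is
Bays–Kirby 2018 Conjecture 1.3 ("`ℂ_exp` is isomorphic to the unique model `𝔹` of `ECF_{SK,CCP}`
of cardinality continuum", arXiv p. 3) read through **Theorem 1.2** ("Up to isomorphism there is
exactly one model of the axioms `ECF_{SK,CCP}` of each uncountable cardinality", ibid.; Zilber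
2005 Thm 1.1), and nothing more: direction `→` *is* the uniqueness half of Theorem 1.2 in
cardinality `𝔠` relative to `ℂ_exp`, direction `←` is vacuous without the existence half, and
everything else (transport of the axioms along an E-ring isomorphism,
`IsZilberField.of_exponentialRingEquiv`, `ZilberFieldTransport.lean`) is proved. The two halves of
Theorem 1.2 are already the named facts `zilber_categoricity` and
`exists_isZilberField_of_aleph0_lt` of `ZilberField.lean`, and the equivalence from them is the
proved theorem `zilberConjecture_iff_forall_nonempty_equiv_of` (`ZilberProofs.lean`, statement
spelled out there). A separate `def … : Prop` for the equivalence therefore only duplicated their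
proof obligation (its one possible discharge being `zilberConjecture_iff_forall_nonempty_equiv_of
zilber_categoricity_holds exists_isZilberField_of_aleph0_lt_holds`); it had no user taking it as
a hypothesis, and it is merged into that theorem: the `def` is removed from this file, no
statement of any remaining declaration changed.

## Mathlib search

Mathlib (this pin) has `Cardinal.mk_complex : #ℂ = 𝔠`, `Cardinal.aleph0_lt_continuum`,
`Complex.isAlgClosed`; `rg -i 'zilber|quasiminimal|pseudo.?exponent'` over Mathlib is empty. All
exponential-field vocabulary comes from the accepted H21 preludes (`IsZilberField`,
`ExponentialRingEquiv`, `HasStandardKernel`, `IsExpAlgClosed`, `IsStronglyExpAlgClosed`,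
`SchanuelProperty`, `Language.expRing`, `Language.IsQuasiminimal`) and statements
(`Literature.Periods.SchanuelConjecture` in Wave0, `Literature.ModelTheory.ExponentialFields.ZilberQuasiminimalityConjecture` in
RealExpField). Nothing new is defined here except the `Prop` `ZilberConjecture`.

## Design choices

* The conjecture is `def ZilberConjecture : Prop := IsZilberField ℂ` (open problem, `def` form
  only). By categoricity + existence of Zilber fields in every uncountable cardinality this is
  equivalent to the isomorphism form; that equivalence is the theorem
  `zilberConjecture_iff_forall_nonempty_equiv_of` of `ZilberProofs.lean` (quantifying over
  `B : Type`, matching the universe-0 convention of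
  `Literature.NumberTheory.Transcendental.zilber_categoricity`), not a declaration of this file.
* `open FirstOrder` only (G06 language-namespace rule), so the language is written
  `Language.expRing`.

## References

* B. Zilber, *Pseudo-exponentiation on algebraically closed fields of characteristic zero*,
  Ann. Pure Appl. Logic 132 (2005) 67–95, Thms 1.1–1.2, Conjecture p. 68, §5 (Lemma 5.12).
* J. Kirby, *A note on the axioms for Zilber's pseudo-exponential fields*, Notre Dame J. Formal
  Logic 54 (2013), 509–520, §2.3 (SEAC is first-order modulo axioms 1–3; EAC = SEAC only known
  under CIT).
* M. Bays, J. Kirby, *Pseudo-exponential maps, variants, and quasiminimality*, Algebra & Number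
  Theory 12 (2018) 493–549, §1: Conjecture 1.1 (weak quasiminimality), Thm 1.2 (categoricity of
  `ECF_{SK,CCP}`), Conjecture 1.3 (strong form), Thm 1.4 (↔ Schanuel + SEAC), Thm 1.5 (EAC ⟹
  quasiminimal); §9.1 Thm 9.1 (the axioms, `𝔹`), §9.2 (categoricity does not prove Schanuel).
* F. Gallinaro, J. Kirby, *Quasiminimality of complex powers*, Forum Math. Sigma 12 (2024) e123,
  arXiv:2304.06450, §1.1 (p. 4: attribution of `ℂ_exp ≅ 𝔹_exp` to Zilber; ↔ Schanuel + SEAC).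
* A. J. Wilkie, *Analytic continuation and Zilber's quasiminimality conjecture*, Model Theory 3
  (2024) 701–719, arXiv:2306.14562, p. 2 (the quasiminimality conjecture is still unresolved).
* V. Aslanyan, F. Gallinaro, *Exponential sums equations and the Exponential Closedness
  conjecture*, arXiv:2409.12860 (2024), §3.5 (p. 15: Schanuel's conjecture is open).
-/

noncomputable section

open Cardinal
open FirstOrder

namespace Literature.NumberTheory.Transcendental

/-! ### The strong form -/

/-- OPEN CONJECTURE — **periods.S30**, **Zilber's conjecture on the complex exponential field**
(strong form; Bays–Kirby's "strong quasiminimality conjecture"): the complex exponential field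
`ℂ_exp = (ℂ; +, ·, exp)` satisfies Zilber's axioms `ECF_{SK,CCP}` of pseudo-exponentiation
(`Literature.NumberTheory.Transcendental.IsZilberField`; Bays–Kirby 2018 Thm 9.1, axioms 1–5):
ELA-field (ACF₀ with `exp` a surjective homomorphism `𝔾ₐ → 𝔾ₘ`), standard kernel, the Schanuel
property, strong exponential-algebraic closedness and the countable closure property. Since models
of `ECF_{SK,CCP}` exist in every uncountable cardinality and are unique up to E-ring isomorphism
(Zilber 2005 Thm 1.1 = Bays–Kirby 2018 Thm 1.2; the named facts
`Literature.NumberTheory.Transcendental.zilber_categoricity` and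
`Literature.NumberTheory.Transcendental.exists_isZilberField_of_aleph0_lt`), this says exactly that
`ℂ_exp` is isomorphic to Zilber's pseudo-exponential field `𝔹` of cardinality continuum
(`Literature.NumberTheory.Transcendental.zilberConjecture_iff_forall_nonempty_equiv_of`,
`ZilberProofs.lean`, granted those two named facts; unconditionally
`Literature.NumberTheory.Transcendental.zilberConjecture_iff_exists_nonempty_equiv`, ibid.).
POSED, not proved, by B. Zilber, *Pseudo-exponentiation on algebraically closed fields of
characteristic zero*, Ann. Pure Appl. Logic 132 (2005) 67–95, Conjecture on p. 68 (with Thm 1.1)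
[cite: Zilber2005PseudoExp, Conjecture p. 68 (conjecture posed; not a theorem; text not held here: acq-00158)],
and verbatim as M. Bays, J. Kirby, Algebra & Number Theory 12 (2018) 493–549 (arXiv:1512.04262,
p. 3), **Conjecture 1.3** (Strong quasiminimality conjecture): "`ℂ_exp` is isomorphic to the
unique model `𝔹` of `ECF_{SK,CCP}` of cardinality continuum" [cite: BaysKirby2018ANT, Conjecture 1.3];
attribution and status also in Gallinaro–Kirby, *Quasiminimality of complex powers*, Forum Math.
Sigma 12 (2024) e123 (arXiv:2304.06450, §1.1, p. 4): "Zilber then conjectured that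
`ℂ_exp ≅ 𝔹_exp`, which implies Conjecture 1.1, but is much stronger, since it incorporates
Schanuel's Conjecture of transcendental number theory. In fact, it is equivalent to that
conjecture together with another conjectural property for `ℂ_exp`, called Strong
Exponential-Algebraic Closedness (SEAC)" [cite: GallinaroKirby2023, §1.1 (p. 4)]. [status: open] —
neither a proof nor a disproof is in print and no `ZilberConjecture_holds` is to be expected: by
Bays–Kirby 2018 **Theorem 1.4** ("Conjecture 1.3 is true if and only if Schanuel's conjecture is
true and `ℂ_exp` is strongly exponentially-algebraically closed", arXiv p. 3), PROVED in the tree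
as `Literature.NumberTheory.Transcendental.zilberConjecture_iff_schanuelConjecture_and_isStronglyExpAlgClosed`
(`ZilberProofs.lean`), the statement is equivalent to
`SchanuelProperty ℂ ∧ IsStronglyExpAlgClosed ℂ`, and "Schanuel's conjecture is considered out of
reach, since even the very simple consequence that the numbers `e` and `π` are algebraically
independent is unknown" (ibid.) [cite: BaysKirby2018ANT, Thm 1.4] — "a famous open problem in
transcendental number theory" (Aslanyan–Gallinaro, arXiv:2409.12860, §3.5, p. 15)
[cite: AslanyanGallinaro2024, §3.5]; moreover the statement implies the weak form, Zilber's
quasiminimality conjecture `Literature.ModelTheory.ExponentialFields.ZilberQuasiminimalityConjecture`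
(`zilberQuasiminimality_of_zilberConjecture`, discharged in `ZilberFieldQuasiminimalityProofs.lean`),
of which "Most readers of this article will know that Boris' conjecture is still unresolved"
(Wilkie, Model Theory 3 (2024), arXiv:2306.14562, p. 2) [cite: Wilkie2024QuasiminimalityMT, p. 2 (arXiv)].
Bays–Kirby 2018 §9.2 add that the categoricity of `𝔹` alone cannot settle it: "Several people
have asked us if it might be possible to prove Schanuel's conjecture easily by some method
showing that `ℂ_exp` must be isomorphic to `𝔹`, just because `𝔹` is categorical. Examples such as
these show that soft methods which ignore transcendental number theory and analytic
considerations cannot hope to work" (catalogued as the barrier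
`Literature.Barriers.Schanuel.AxiomsDoNotForceSchanuel`). Registered here as an OPEN statement
(CONVENTIONS §4: a `def … : Prop`, never asserted), not as named-fact debt; users keep the
explicit hypothesis `(h : ZilberConjecture)` (projections `ZilberConjecture.schanuelConjecture`,
`ZilberConjecture.isStronglyExpAlgClosed` in `ZilberProofs.lean`; route file
`Summits/Schanuel/Schanuel/Theses/Zilber.lean`). The name already has the `…Conjecture` form and
is kept, with the body `IsZilberField ℂ` literally unchanged, because those files refer to it. -/
@[conjecture] def ZilberConjecture : Prop :=
  IsZilberField ℂ

/- The isomorphism form `ZilberConjecture ↔ ∀ B, IsZilberField B → #B = 𝔠 → Nonempty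
(ExponentialRingEquiv B ℂ)` (Bays–Kirby 2018 Conjecture 1.3 read through Thm 1.2) is the proved
theorem `zilberConjecture_iff_forall_nonempty_equiv_of` of `ZilberProofs.lean` (granted the named
facts `zilber_categoricity`, `exists_isZilberField_of_aleph0_lt`); the former named fact of this
file with that statement was merged into it (module docstring, `## Merged named fact`). -/

/-- The complex exponential field has standard kernel: `ker exp = 2πiℤ`
(`Literature.ModelTheory.ExponentialFields.ExponentialRing.mem_expKernel_complex_iff`) with `2πi` transcendental over `ℚ`, by
Lindemann's theorem `Literature.NumberTheory.Transcendental.transcendental_pi` (**periods.S11**, Wave0) and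
`Literature.NumberTheory.Transcendental.hasStandardKernel_complex_of_transcendental_pi`. Zilber 2005 §1.
[cite: Zilber2005PseudoExp, §1] -/
def hasStandardKernel_complex : Prop :=
  HasStandardKernel ℂ

/- interim proof relied on results that are now named facts (D-0014); demoted to a fact by the M5
import, proof preserved:
:=
  hasStandardKernel_complex_of_transcendental_pi transcendental_pi
-/

/-! ### The weak form: quasiminimality of `ℂ_exp` -/

/-- **periods.S30** (weak form link; Zilber 2005 Thm 1.2; Bays–Kirby 2018 Thm 1.2). The strong
form of Zilber's conjecture implies the weak form `Literature.ModelTheory.ExponentialFields.ZilberQuasiminimalityConjecture`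
(every `Language.expRing`-definable subset of `ℂ` is countable or co-countable), because every
Zilber field is quasiminimal (`Literature.NumberTheory.Transcendental.IsZilberField.isQuasiminimal`).
[cite: Zilber2005PseudoExp, Thm 1.2] [cite: BaysKirby2018ANT, Thm 1.2] -/
def zilberQuasiminimality_of_zilberConjecture : Prop :=
  ∀ (h : ZilberConjecture),
    Literature.ModelTheory.ExponentialFields.ZilberQuasiminimalityConjecture

/- interim proof relied on results that are now named facts (D-0014); demoted to a fact by the M5
import, proof preserved:
:=
  h.isQuasiminimal
-/

/-- **periods.S30** (weak form, definitional link; Zilber 2005 §1; Bays–Kirby 2018 §1). Zilber's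
quasiminimality conjecture `Literature.ModelTheory.ExponentialFields.ZilberQuasiminimalityConjecture` (RealExpField) is literally
quasiminimality of the `Language.expRing`-structure `ℂ` in the sense of
`FirstOrder.Language.IsQuasiminimal`. [cite: BaysKirby2018ANT, Conjecture 1.1] -/
theorem zilberQuasiminimalityConjecture_iff :
    Literature.ModelTheory.ExponentialFields.ZilberQuasiminimalityConjecture ↔ Literature.ModelTheory.ExponentialFields.Language.expRing.IsQuasiminimal ℂ :=
  Iff.rfl

/-- **Bays–Kirby** (Algebra & Number Theory 12 (2018) 493–549, Theorem 1.5). If `ℂ_exp` is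
exponentially-algebraically closed then it is quasiminimal — unconditionally in Schanuel's
conjecture: Bays–Kirby show that `ℂ_exp` with EAC is a model of the theory of
pseudo-exponentiation without the Schanuel property, all of whose models with CCP are
quasiminimal. [cite: BaysKirby2018ANT, Thm 1.5] -/
def isQuasiminimal_of_isExpAlgClosed : Prop :=
  ∀ (hEAC : IsExpAlgClosed ℂ),
    Literature.ModelTheory.ExponentialFields.Language.expRing.IsQuasiminimal ℂ

end Literature.NumberTheory.Transcendental
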